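import Summits.QuantumFields.Balaban3D.Proofs.UVStability3D

/-!
# Bałaban CMP 102 (1985), d = 3 lane — `Proofs.NegativeEdge`: the literal reading of Theorem 1 FAILS on the concrete families of
# `Proofs.UVStability3D` (PLAN §0.4; cell pub-balaban GAPS G-B10-01), side by side with the certified compact reading

Source: T. Bałaban, CMP **102** (1985) 255–275 [Balaban1985UV3]; Theorem 1 p. 257, (62) p. 271 «E^{(k)} = log σ₀|T₁^{(k)*}| + d(𝔤) log
g_k|T₁^{(k)*}| + …».  Lane `pub-balaban3d`, seat p3 (PLAN §3.1 p3 «plus the literal-reading negative edge for `run3` from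
`not_thm1Printed_of_leafSystems`»).

WHAT THIS FILE PROVES: for towers carrying concrete leaf bundles (`UVStability3D.ConcreteLeaves`), a group with `d(𝔤) ≥ d₀ > 0` in the
step pieces (reader's item (R3) of `B10DagLeaf`) and the unit configuration at level 0 ((R1) `B10DagLeaf.UnitConfig0`), and a family
containing arbitrarily fine lattices, `¬ B10.Thm1Printed` — the 4D cell's `B10StarLower.not_thm1Printed_of_concreteStar_fineLattices`
with (R2) DISCHARGED by the concrete star count `(7/4)|T₁^{(k)}| ≤ |T₁^{(k)*}|`; the fine-lattice hypothesis is DISCHARGED for the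
family of all `Scales L` (`scales_fine`) and for the exhibited family `S.ε₀ = ε₀(S.g)` of ruling R-EPS0′
(`ScalesArithmetic.scales_fine_eps0Of`).  `compact_not_literal_eps0`: `(Thm1PrintedCompact ∧ Thm2Printed) ∧ ¬ Thm1Printed` on
`Theorems.runs mk G 𝔊 (eps0Of γ₀)`.  A statement about the TYPING `B10.Thm1Printed`, not about Yang–Mills; d(𝔤) ≥ 1 is a genuine
hypothesis (Mathlib's `LieAlgebra.IsSemisimple` holds for 𝔤 = 0, lane STATUS P3-F2).
-/

namespace Summit.QuantumFields.Balaban3D.Proofs.NegativeEdge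

open Literature.MathematicalPhysics.QuantumFieldTheory.Balaban1983to89
open Literature.MathematicalPhysics.QuantumFieldTheory.Balaban1983to89.B10
open Literature.MathematicalPhysics.QuantumFieldTheory.Balaban1983to89.B10SectAGathering
open Literature.MathematicalPhysics.QuantumFieldTheory.Balaban1985CMP102.Setting
open Literature.MathematicalPhysics.QuantumFieldTheory.Balaban1985CMP102.Theorems
open Summit.QuantumFields.Balaban3D.Proofs.ScalesArithmetic
open Summit.QuantumFields.Balaban3D.Proofs.Constants
open Summit.QuantumFields.Balaban3D.Proofs.UVStability3D

variable {L : ℕ}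

/-! ## §1 The negative edge for concrete families (PLAN §0.4, G-B10-01) -/

/-- **¬ THEOREM 1 IN THE LITERAL (one-sided) READING for concrete families**: towers over `D` carrying concrete leaf bundles
(as in `uvStability3D_compact_family`), a group with `d(𝔤) ≥ d₀ > 0` at every step (reader's item (R3) of `B10DagLeaf`), the unit
configuration as a level-0 configuration with zero action and χ = 1 ((R1), `B10DagLeaf.UnitConfig0`), and approximations with at
least one step and ARBITRARILY SMALL bare coupling `g₀² = g²ε` in the family (e.g. all ε at fixed g) give `¬ B10.Thm1Printed D`.
The star-count item (R2) is NOT a hypothesis: the concrete count `(7/4)|T₁^{(k)}| ≤ |T₁^{(k)*}|` (`B10StarLower`) discharges it.  By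
(62) p. 271 `−E` contains `d(𝔤)|T₁^{(j)*}| log g_j⁻¹`, unbounded per site as g₀ → 0 (`B10DagLeaf`).  Side by side with §2: the
compact reading holds, the literal one fails, on the same concrete leaf bundles. [cite: Balaban1985UV3, Thm 1 p.257 + (62) p.271] -/
theorem not_thm1Printed_concrete {I : Type} (C : B10Assembly.Consts) (hC : NormalisedConsts L C)
    (D : I → RunData) (S : I → Scales L) (T : I → TowerRun)
    (hT : ∀ i, (T i).toRunData = D i) (X : ∀ i, ConcreteLeaves C (S i) (T i))
    {d₀ : ℝ} (hd : 0 < d₀) (hD : ∀ (i : I) (k : ℕ) (hk : k + 1 ≤ (T i).K), d₀ ≤ ((X i).steps k hk).P.dg)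
    (hU : ∀ i, B10DagLeaf.UnitConfig0 (T i))
    (hfine : ∀ δ : ℝ, 0 < δ → ∃ i, 1 ≤ (S i).K ∧ (S i).g0sq < δ) :
    ¬ Thm1Printed D := by
  have hfun : (fun i => (T i).toRunData) = D := funext hT
  rw [← hfun]
  refine B10StarLower.not_thm1Printed_of_concreteStar_fineLattices T
    (fun i => leafSystem_of_concrete hC (X i)) (fun i => (S i).P) (fun i => P_d (S i)) (fun _ k => k)
    (fun i k hk => by have := (X i).K_eq; show k + 1 ≤ (S i).m + (S i).K; omega)
    (fun i k hk => (X i).starT_eq k hk)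
    (fun i k hk => by
      rw [(X i).sites_eq]
      exact sites_eq_card (S i) k (by have := (X i).K_eq; omega))
    hd hU (fun i k hk => hD i k hk) ?_
  intro δ hδ
  obtain ⟨i, hK, hε⟩ := hfine δ hδ
  refine ⟨i, ?_, ?_, hε⟩
  · rw [(X i).K_eq]; exact hK
  · exact mul_pos (pow_pos (S i).g_pos 6) (volT_pos (S i))

/-- THE FINE-LATTICE HYPOTHESIS IS MET by the family of ALL lattice approximations `Scales L`: for every `δ > 0` there is an
approximation with one step (`K = 1`, `m = 0`), coupling `g = 1`, spacing `ε = min(L⁻¹, δ/2)` and `ε₀ = Lε ≤ 1` (so `g²ε₀ ≤ 1`)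
with `g₀² = ε < δ` — p. 256: at fixed `g` the paper's family contains arbitrarily fine lattices.  (Needs only the standing
`Odd L ∧ 1 < L` of `Setup.Params`.) [cite: Balaban1985UV3, (2)–(3) p.256] -/
theorem scales_fine (hL : Odd L ∧ 1 < L) (δ : ℝ) (hδ : 0 < δ) : ∃ S : Scales L, 1 ≤ S.K ∧ S.g0sq < δ := by
  have hL1 : (1 : ℝ) < L := by exact_mod_cast hL.2
  have hL0 : (0 : ℝ) < L := lt_trans one_pos hL1
  set e : ℝ := min ((L : ℝ)⁻¹) (δ / 2) with he
  have he0 : 0 < e := lt_min (inv_pos.mpr hL0) (by linarith)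
  have heL : e ≤ (L : ℝ)⁻¹ := min_le_left _ _
  have heδ : e ≤ δ / 2 := min_le_right _ _
  have hsmall : (1 : ℝ) ^ 2 * ((L : ℝ) * e) ≤ 1 := by
    have := mul_le_mul_of_nonneg_left heL hL0.le
    rw [mul_inv_cancel₀ hL0.ne'] at this
    linarith
  -- fields in order: hL, m, K, ε, ε_pos, ε₀, hK, g, g_pos, gK_le_one
  refine ⟨⟨hL, 0, 1, e, he0, (L : ℝ) * e, by rw [pow_one], 1, one_pos, hsmall⟩, le_rfl, ?_⟩
  show (1 : ℝ) ^ 2 * e < δ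
  linarith

/-- **THE NEGATIVE EDGE ON THE FAMILY OF ALL LATTICE APPROXIMATIONS** (v2 reading, kept for record): with tower carriers and
concrete leaf bundles for every `S : Scales L`, one group with `d(𝔤) ≥ d₀ > 0` in the step pieces ((R3)) and the unit
configuration at level 0 ((R1)), `¬ B10.Thm1Printed (fun S : Scales L => (mk G 𝔊 S).toRunData)` — the family contains
arbitrarily fine lattices (`scales_fine`); (62) p. 271, G-B10-01. [cite: Balaban1985UV3, Thm 1 p.257 + (62) p.271] -/
theorem not_thm1Printed_all (mk : Construction L) (C : B10Assembly.Consts) (hC : NormalisedConsts L C)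
    (tower : ∀ (G : Type) [GaugeGroup G] [MeasurableSpace G] [HaarData G], GroupModel G → Scales L → TowerRun)
    (hT : ∀ (G : Type) [GaugeGroup G] [MeasurableSpace G] [HaarData G] (𝔊 : GroupModel G) (S : Scales L),
      (tower G 𝔊 S).toRunData = (mk G 𝔊 S).toRunData)
    (hL : Odd L ∧ 1 < L)
    (G : Type) [GaugeGroup G] [MeasurableSpace G] [HaarData G] (𝔊 : GroupModel G)
    (X : ∀ S : Scales L, ConcreteLeaves C S (tower G 𝔊 S))
    {d₀ : ℝ} (hd : 0 < d₀) (hD : ∀ (S : Scales L) (k : ℕ) (hk : k + 1 ≤ (tower G 𝔊 S).K), d₀ ≤ ((X S).steps k hk).P.dg)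
    (hU : ∀ S : Scales L, B10DagLeaf.UnitConfig0 (tower G 𝔊 S)) :
    ¬ Thm1Printed (fun S : Scales L => (mk G 𝔊 S).toRunData) :=
  not_thm1Printed_concrete C hC (fun S => (mk G 𝔊 S).toRunData) (fun S => S) (fun S => tower G 𝔊 S)
    (fun S => hT G 𝔊 S) X hd hD hU (scales_fine hL)

/-! ## §2 On the exhibited family of ruling R-EPS0′ -/

/-- **THE NEGATIVE EDGE ON THE EXHIBITED FAMILY** (R-EPS0′ shape; PLAN §0.4, G-B10-01): for the construction's own `ε₀(g) =
(min γ₀ 1)²/g²` and a group with `d(𝔤) ≥ d₀ > 0` in the step pieces ((R3)) and the unit configuration at level 0 ((R1)),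
`¬ B10.Thm1Printed (fun S : {S // S.ε₀ = ε₀(S.g)} => (mk G 𝔊 S.1).toRunData)` — the exhibited family contains arbitrarily fine
lattices (`ScalesArithmetic.scales_fine_eps0Of`: g = 1, K → ∞), so by (62) p. 271 the literal reading fails there while
`uvStability3D_compact_eps0` certifies the compact reading on the same family with the same `eps0`. [cite: Balaban1985UV3, Thm 1 p.257 + (62) p.271] -/
theorem not_thm1Printed_eps0 (mk : Construction L) (C : B10Assembly.Consts) (hC : NormalisedConsts L C)
    (tower : ∀ (G : Type) [GaugeGroup G] [MeasurableSpace G] [HaarData G], GroupModel G → Scales L → TowerRun)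
    (hT : ∀ (G : Type) [GaugeGroup G] [MeasurableSpace G] [HaarData G] (𝔊 : GroupModel G) (S : Scales L),
      (tower G 𝔊 S).toRunData = (mk G 𝔊 S).toRunData)
    (hL : Odd L ∧ 1 < L) {γ₀ : ℝ} (hγ : 0 < γ₀)
    (G : Type) [GaugeGroup G] [MeasurableSpace G] [HaarData G] (𝔊 : GroupModel G)
    (X : ∀ S : Scales L, S.ε₀ = eps0Of γ₀ S.g → ConcreteLeaves C S (tower G 𝔊 S))
    {d₀ : ℝ} (hd : 0 < d₀)
    (hD : ∀ (S : Scales L) (hS : S.ε₀ = eps0Of γ₀ S.g) (k : ℕ) (hk : k + 1 ≤ (tower G 𝔊 S).K),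
      d₀ ≤ ((X S hS).steps k hk).P.dg)
    (hU : ∀ S : Scales L, S.ε₀ = eps0Of γ₀ S.g → B10DagLeaf.UnitConfig0 (tower G 𝔊 S)) :
    ¬ Thm1Printed (fun S : {S : Scales L // S.ε₀ = eps0Of γ₀ S.g} => (mk G 𝔊 S.1).toRunData) :=
  not_thm1Printed_concrete C hC (fun S : {S : Scales L // S.ε₀ = eps0Of γ₀ S.g} => (mk G 𝔊 S.1).toRunData)
    (fun S => S.1) (fun S => tower G 𝔊 S.1) (fun S => hT G 𝔊 S.1) (fun S => X S.1 S.2) hd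
    (fun S k hk => hD S.1 S.2 k hk) (fun S => hU S.1 S.2) (fun δ hδ => by
      obtain ⟨S, _, hε, hK, hs⟩ := scales_fine_eps0Of hL hγ one_pos δ hδ
      exact ⟨⟨S, hε⟩, hK, hs⟩)

/-- … and, with the SAME witness `eps0 := eps0Of γ₀`, the literal reading fails on that family for a group with `d(𝔤) ≥ d₀ > 0`
and the unit configuration (`not_thm1Printed_eps0`) — so `Thm1AsPrinted mk` cannot be obtained through the construction's own
ε₀(g); whether some OTHER choice of ε₀(·) rescues the literal reading is not decidable from the leaves (they exist only where
g_k ≤ γ₀).  Recorded as the lane's form of G-B10-01. [cite: Balaban1985UV3, Thm 1 p.257 + (62) p.271] -/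
theorem compact_not_literal_eps0 (mk : Construction L) (C : B10Assembly.Consts) (hC : NormalisedConsts L C)
    (tower : ∀ (G : Type) [GaugeGroup G] [MeasurableSpace G] [HaarData G], GroupModel G → Scales L → TowerRun)
    (hT : ∀ (G : Type) [GaugeGroup G] [MeasurableSpace G] [HaarData G] (𝔊 : GroupModel G) (S : Scales L),
      (tower G 𝔊 S).toRunData = (mk G 𝔊 S).toRunData)
    (hL : Odd L ∧ 1 < L) {γ₀ : ℝ} (hγ : 0 < γ₀)
    (G : Type) [GaugeGroup G] [MeasurableSpace G] [HaarData G] (𝔊 : GroupModel G)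
    (X : ∀ S : Scales L, S.ε₀ = eps0Of γ₀ S.g → ConcreteLeaves C S (tower G 𝔊 S))
    {d₀ : ℝ} (hd : 0 < d₀)
    (hD : ∀ (S : Scales L) (hS : S.ε₀ = eps0Of γ₀ S.g) (k : ℕ) (hk : k + 1 ≤ (tower G 𝔊 S).K),
      d₀ ≤ ((X S hS).steps k hk).P.dg)
    (hU : ∀ S : Scales L, S.ε₀ = eps0Of γ₀ S.g → B10DagLeaf.UnitConfig0 (tower G 𝔊 S)) :
    (Thm1PrintedCompact (runs mk G 𝔊 (eps0Of γ₀)) ∧ Thm2Printed (runs mk G 𝔊 (eps0Of γ₀)))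
      ∧ ¬ Thm1Printed (runs mk G 𝔊 (eps0Of γ₀)) :=
  ⟨uvStability3D_compact_subfamily mk C hC tower hT (fun S : Family L (eps0Of γ₀) => S.1) G 𝔊 (fun S => X S.1 S.2),
    not_thm1Printed_eps0 mk C hC tower hT hL hγ G 𝔊 X hd hD hU⟩

end Summit.QuantumFields.Balaban3D.Proofs.NegativeEdge
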